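import Literature.AnabelianGeometry.EtaleTheta.ThetaKummerInversionFixedPoints
import Literature.AnabelianGeometry.EtaleTheta.Discharge.Sec1DeckNegatesCoordModelChi
import Literature.AnabelianGeometry.EtaleTheta.Discharge.Sec1Thm110ModelChiInversionNV
import HarnessLib

/-!
# NO `b`-axis lift `Ad(b^s) ∘ ι` of the inversion of record carries the FUNCTION-level [EtTh] Prop 1.4 (ii) package at
# the χ-twisted root model: odd lifts fix a 4-torsion Def. 1.9 section, even lifts a cuspidal one (proof-only)

S. Mochizuki, *The étale theta function …*, Publ. RIMS **45** (2009) [EtTh]: Prop 1.4 (ii) p. 22 («`Θ̈(Ü) = −Θ̈(Ü⁻¹)`»,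
«`Θ̈(−Ü) = −Θ̈(Ü)`»), Def 1.9 p. 29 (`τ`, `τ⁻¹` — the 4-torsion points `Ü = ±√−1`), Def 2.1 / §2 p. 36 (the inversion
`ι`). Classical here. [cite: MochizukiEtTh2009, Prop 1.4 (ii) p.22]

abc-iut cell, layer L2, seat abc-iut-w5-d140 (gen 4), K2 holder (SUBDAG EtTh:Thm1.10); self-named PROOF-ONLY row «no
`b`-axis lift of `ι` carries the function-level package @ modelχ» (NO definition, NO instance, NO `Prop` fact; D-0067).
INPUTS, ALL BY NAME: abc-iut-w5-d125's no-go **`KummerCore.not_exists_package_of_constCompat_of_fixed`** (p448036: an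
inversion lift fixing pointwise a subgroup `H₀ ≤ Π^tp_Ÿ` whose Galois image is `G_L`, `L/ℚ_p` finite, admits NO pull-back
`ιFn` with `hιFn ∧ hΛ ∧ hιθ` for a `T` compatible with the genuine Kummer data) and its model lemmas
`inrRange_le_GtpYdd_modelχ` / `map_map_inrRange_augTheta_kummerCoreχ`; abc-iut-L2-d1's inversion of record
`twistedInversionTop (chi p) …` (= this seat's abbrev `invχ`, `twistedInversion_inl/_inr`); this seat's K2 results
**`exists_invχ_sectionOfUnitχ_conj`** (p445493: `ι(s_{√−1}(σ)) = b^{2c₀}·s_{(√−1)⁻¹}(σ)·b^{−2c₀}`) and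
**`exists_odd_deck_exponent`** (p447647: the deck element `b^t`, `b^t·s_{(√−1)⁻¹}(σ)·b^{−t} = s_{√−1}(σ)`, has `t` ODD);
abc-iut-L2-t6's `sectionχ` / `sectionOfUnitχ` / `map_sectionOfUnitχ_GKdd_le_GtpYdd`. Nothing of abc-iut-w5-d118's R413
(«inversion vs the Def 1.9 sections», arbitrary unit `u`) is restated — (D) there at `u = √−1` IS p445493, consumed.

RESULTS (`ι := invχ p`, `b^s := inl (bPowGfp s)`):
* **`exists_odd_bTwist_invχ_fix_sectionOfUnitχ`** (`p ≡ 1 (mod 4)`): there is an ODD `s₀ ∈ Ẑ` (`s₀ = t − 2c₀`) with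
  `b^{s₀} · ι(s_{√−1}(σ)) · b^{−s₀} = s_{√−1}(σ)` for ALL `σ ∈ G_{ℚ_p}` — the deck-corrected odd lift `Ad(b^{s₀}) ∘ ι` FIXES
  THE 4-TORSION SECTION OF `τ` POINTWISE (print: the inversion `Ü ↦ −Ü⁻¹` fixes `±√−1`). The oddness of the K2 deck
  exponent is exactly what makes this lift one of abc-iut-w5-d125's «`Ad(w) ∘ ι` with odd `ŷ(w)`».
* **`not_exists_package_modelχ_evenBTwist_of_constCompat`** (all `p`, every EVEN `s = m²`): `Ad(b^s) ∘ ι =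
  Ad(b^m) ∘ ι ∘ Ad(b^m)⁻¹` fixes `Ad(b^m)(inr G_{ℚ_p}) ≤ Π^tp_Ÿ` pointwise (Galois image `G_{ℚ_p}`) ⇒ NO package.
* **`not_exists_package_modelχ_oddBTwist_of_constCompat`** (`p ≡ 1 (4)`, every ODD `s = m²·s₀`): `Ad(b^s) ∘ ι` fixes
  `Ad(b^m)(D_τ) ≤ Π^tp_Ÿ` pointwise (Galois image `G_K̈`, `K̈/ℚ_p` finite) ⇒ NO package; together
  **`not_exists_package_modelχ_bTwist_of_constCompat`** (`p ≡ 1 (4)`, EVERY `s ∈ Ẑ`), for every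
  `ι' : Π^tp_X ≃ₜ* Π^tp_X` agreeing with `Ad(b^s) ∘ ι` pointwise; `exists_continuousMulEquiv_bTwist_invχ` (such `ι'`
  exist — the `∀ ι'` is not vacuous).
CENSUS SENTENCE (model design, numbers not a side): abc-iut-w5-d125's memo (5) escape «a `Π^tp_X`-conjugate `Ad(w) ∘ ι`
with odd `ŷ(w)`» is CLOSED ON THE `b`-AXIS: at (`modelχ`, genuine constants) no `Ad(b^s) ∘ ι` (`s` even; or any `s` when
`p ≡ 1 (4)`) admits the function-level package; surviving candidates are lifts OFF the `b`-axis (e.g. central twists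
`Ad(c^z) ∘ ι`, `c^z ∈ Δ_Θ ≤ Π^tp_Ÿ`, which act on `H¹(Π^tp_Ÿ, Δ_Θ)` exactly as `ι`).

HONEST FRAMING: classical group theory over the cell's typed interface and its SEMI-SYNTHETIC χ-model (consistency
evidence only); nothing disputed is asserted; no side is taken on [IUTchIII] Cor 3.12; typed ≠ proved elsewhere.
-/

noncomputable section

namespace Literature.AnabelianGeometry.EtaleTheta.SettingModel

open Literature.IUT.HodgeArakelov Literature.AnabelianGeometry.SemiGraphs
open Literature.AnabelianGeometry.AbsoluteAnabelian
open _root_.Topology _root_.Function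

variable (p : ℕ) [Fact p.Prime]

/-! ### §0. Group-theoretic plumbing -/

/-- `a·(b·x·b⁻¹)·a⁻¹ = (ab)·x·(ab)⁻¹`. [folklore] -/
private theorem conj_conj' {G : Type*} [Group G] (a b x : G) : a * (b * x * b⁻¹) * a⁻¹ = a * b * x * (a * b)⁻¹ := by
  group

/-- `ι` is inversion on the `b`-axis: `ι(b^x) = b^{x⁻¹}`. [cite: MochizukiEtTh2009, §2 p.36] -/
theorem invχ_inl_bPowGfp (x : ZH) :
    invχ p (SemidirectProduct.inl (bPowGfp x)) = SemidirectProduct.inl (bPowGfp x⁻¹) := by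
  rw [twistedInversionTop_apply, twistedInversion_inl, gfpInv_bPowGfp_eq]

/-- `ι` fixes the complement: `ι(inr σ) = inr σ`. [cite: MochizukiEtTh2009, §2 p.36] -/
theorem invχ_inr (σ : GQp p) :
    invχ p (SemidirectProduct.inr σ) = SemidirectProduct.inr σ := by
  rw [twistedInversionTop_apply, twistedInversion_inr]

/-- `ι` through a `b`-conjugation: `ι(b^m·x·b^{−m}) = b^{m⁻¹}·ι(x)·b^{−m⁻¹}`. [cite: MochizukiEtTh2009, §2 p.36] -/
theorem invχ_conj_inl_bPowGfp (m : ZH) (x : PiTpχ p) :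
    invχ p ((SemidirectProduct.inl (bPowGfp m) : PiTpχ p) * x * (SemidirectProduct.inl (bPowGfp m))⁻¹) =
      (SemidirectProduct.inl (bPowGfp m⁻¹) : PiTpχ p) * invχ p x * (SemidirectProduct.inl (bPowGfp m⁻¹))⁻¹ := by
  rw [map_mul, map_mul, map_inv, invχ_inl_bPowGfp]

/-- The augmentation kills `b`-conjugations: `aug(b^m·x·b^{−m}) = aug x`. [cite: MochizukiEtTh2009, §1 p.12] -/
theorem aug_conj_inl_bPowGfp (m : ZH) (x : PiTpχ p) :
    (ThetaSetting.modelχ p).aug ((SemidirectProduct.inl (bPowGfp m) : PiTpχ p) * x * (SemidirectProduct.inl (bPowGfp m))⁻¹) =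
      (ThetaSetting.modelχ p).aug x := by
  rw [map_mul, map_mul, map_inv]
  have h1 : (ThetaSetting.modelχ p).aug (SemidirectProduct.inl (bPowGfp m) : PiTpχ p) = 1 := rfl
  rw [h1, one_mul, inv_one, mul_one]

/-- The `b`-twisted lifts `Ad(b^s) ∘ ι` are topological automorphisms of `Π^tp_X` (so the `∀ ι'` below is not vacuous).
[cite: MochizukiEtTh2009, §2 p.36] -/
theorem exists_continuousMulEquiv_bTwist_invχ (s : ZH) :
    ∃ ι' : PiTpχ p ≃ₜ* PiTpχ p, ∀ x,
      ι' x = (SemidirectProduct.inl (bPowGfp s) : PiTpχ p) * invχ p x * (SemidirectProduct.inl (bPowGfp s))⁻¹ :=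
  ⟨(invχ p).trans
    { toMulEquiv := MulAut.conj (SemidirectProduct.inl (bPowGfp s) : PiTpχ p)
      continuous_toFun := by
        change Continuous fun x : PiTpχ p =>
          (SemidirectProduct.inl (bPowGfp s) : PiTpχ p) * x * (SemidirectProduct.inl (bPowGfp s))⁻¹
        exact (continuous_const.mul continuous_id).mul continuous_const
      continuous_invFun := by
        change Continuous fun x : PiTpχ p =>
          (SemidirectProduct.inl (bPowGfp s) : PiTpχ p)⁻¹ * x * SemidirectProduct.inl (bPowGfp s)
        exact (continuous_const.mul continuous_id).mul continuous_const }, fun _ => rfl⟩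

/-! ### §1. The deck-corrected ODD lift fixes the 4-torsion section of `τ` pointwise (`p ≡ 1 (mod 4)`) -/

/-- The deck identity on sections with an ODD exponent (p447647, restated on `sectionOfUnitχ`). [cite: MochizukiEtTh2009, Def 1.9 p.29] -/
private theorem odd_deck_section' (hp : p % 4 = 1) :
    ∃ t : ZH, ZHatLevel.level 2 t ≠ 1 ∧ ∀ σ : GQp p,
      (SemidirectProduct.inl (bPowGfp t) : PiTpχ p) * sectionOfUnitχ p (sqrtNegOneInvUnitχ p hp) σ *
          (SemidirectProduct.inl (bPowGfp t))⁻¹ = sectionOfUnitχ p (sqrtNegOneUnitχ p hp) σ := by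
  obtain ⟨t, ht, hodd⟩ := exists_odd_deck_exponent p hp
  refine ⟨t, hodd, fun σ => ?_⟩
  rw [sectionOfUnitχ_def, sectionOfUnitχ_def]
  refine SemidirectProduct.ext ?_ ?_
  · rw [inl_bPowGfp_conj_sectionχ_left, sectionχ_left, Pi.mul_apply, Pi.mul_apply, ht σ]
  · rw [inl_bPowGfp_conj_sectionχ_right, sectionχ_right]

/-- **The deck-corrected odd lift `Ad(b^{s₀}) ∘ ι` FIXES the section of `τ` POINTWISE** (`p ≡ 1 (mod 4)`): there is an
ODD `s₀ ∈ Ẑ` with `b^{s₀} · ι(s_{√−1}(σ)) · b^{−s₀} = s_{√−1}(σ)` for every `σ ∈ G_{ℚ_p}` — `s₀ := t·(2c₀)⁻¹` from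
`ι(s_{√−1}) = Ad(b^{2c₀}) s_{(√−1)⁻¹}` (p445493) and the odd deck identity `Ad(b^t) s_{(√−1)⁻¹} = s_{√−1}` (p447647).
Print: the inversion `Ü ↦ −Ü⁻¹` of `Ÿ` fixes the 4-torsion points `Ü = ±√−1`. [cite: MochizukiEtTh2009, Def 1.9 p.29] -/
theorem exists_odd_bTwist_invχ_fix_sectionOfUnitχ (hp : p % 4 = 1) :
    ∃ s₀ : ZH, ZHatLevel.level 2 s₀ ≠ 1 ∧ ∀ σ : GQp p,
      (SemidirectProduct.inl (bPowGfp s₀) : PiTpχ p) * invχ p (sectionOfUnitχ p (sqrtNegOneUnitχ p hp) σ) *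
          (SemidirectProduct.inl (bPowGfp s₀))⁻¹ = sectionOfUnitχ p (sqrtNegOneUnitχ p hp) σ := by
  obtain ⟨c₀, hc₀⟩ := exists_invχ_sectionOfUnitχ_conj p hp
  obtain ⟨t, hodd, ht⟩ := odd_deck_section' p hp
  refine ⟨t * (c₀ * c₀)⁻¹, ?_, fun σ => ?_⟩
  · -- parity: squares die mod 2
    have hsq : ∀ z : Multiplicative (ZMod ((2 : ℕ+) : ℕ)), (z * z)⁻¹ = 1 := by decide
    rw [map_mul, map_inv, map_mul, hsq, mul_one]
    exact hodd
  · have key : (SemidirectProduct.inl (bPowGfp (t * (c₀ * c₀)⁻¹)) : PiTpχ p) * SemidirectProduct.inl (bPowGfp (c₀ * c₀)) =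
        SemidirectProduct.inl (bPowGfp t) := by
      rw [← map_mul, ← map_mul, inv_mul_cancel_right]
    rw [hc₀ σ, conj_conj', key, ht σ]

/-! ### §2. EVEN lifts fix a conjugate of the cuspidal section `inr G_{ℚ_p}` pointwise — NO package (all `p`) -/

/-- **NO-GO for every EVEN `b`-axis lift** (all `p`): for `s = m²` and any `ι' : Π^tp_X ≃ₜ* Π^tp_X` agreeing pointwise with
`Ad(b^s) ∘ ι`, `ι'` fixes `Ad(b^m)(inr G_{ℚ_p}) ≤ Π^tp_Ÿ` pointwise, whose Galois image is all of `G_{ℚ_p}`; so for every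
theta-Kummer input `T` compatible with the genuine Kummer data `kummerDataχ p` there is NO pull-back `ιFn` with
`hιFn ∧ hΛ ∧ hιθ` (abc-iut-w5-d125's no-go). [cite: MochizukiEtTh2009, Prop 1.4 (ii) p.22] -/
theorem not_exists_package_modelχ_evenBTwist_of_constCompat (T : (ThetaSetting.modelχ p).ThetaKummerInput)
    (hcc : T.ConstCompat (kummerDataχ p)) {s : ZH} (hs : s ∈ sqHom.range) (ι' : PiTpχ p ≃ₜ* PiTpχ p)
    (hι' : ∀ x, ι' x = (SemidirectProduct.inl (bPowGfp s) : PiTpχ p) * invχ p x * (SemidirectProduct.inl (bPowGfp s))⁻¹) :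
    ¬ ∃ ιFn : T.Fn →* T.Fn,
      (letI := T.instAction; ∀ (g : (ThetaSetting.modelχ p).PiTemp) (f : T.Fn),
        ιFn (g • f) = (ι' : (ThetaSetting.modelχ p).PiTemp ≃ₜ* (ThetaSetting.modelχ p).PiTemp) g • ιFn f) ∧
      (∀ ζ : cyclotome T.Fn, cyclotome.map ιFn ζ = ζ) ∧ ιFn T.theta = T.const (-1) * T.theta := by
  obtain ⟨m, rfl⟩ := hs
  haveI := (ThetaSetting.modelχ p).compat.GtpYdd_normal
  haveI : FiniteDimensional ℚ_[p] (⊥ : IntermediateField ℚ_[p] (PadicAlgCl p)) := inferInstance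
  -- the fixed subgroup `Ad(b^m)(inr G_{ℚ_p})`
  have hle : (((SemidirectProduct.inr : GQp p →* PiTpχ p).range : Subgroup (PiTpχ p)).map
      (MulAut.conj (SemidirectProduct.inl (bPowGfp m) : PiTpχ p)).toMonoidHom) ≤ (ThetaSetting.modelχ p).GtpYdd := by
    rintro _ ⟨x, hx, rfl⟩
    rw [MulEquiv.coe_toMonoidHom, MulAut.conj_apply]
    exact Subgroup.Normal.conj_mem inferInstance _ (inrRange_le_GtpYdd_modelχ p hx) _
  have hfix : ∀ g ∈ (((SemidirectProduct.inr : GQp p →* PiTpχ p).range : Subgroup (PiTpχ p)).map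
      (MulAut.conj (SemidirectProduct.inl (bPowGfp m) : PiTpχ p)).toMonoidHom), ι' g = g := by
    rintro _ ⟨_, ⟨σ, rfl⟩, rfl⟩
    rw [MulEquiv.coe_toMonoidHom, MulAut.conj_apply, hι', invχ_conj_inl_bPowGfp, invχ_inr, conj_conj', ← map_mul,
      ← map_mul, sqHom_apply, pow_two, mul_inv_cancel_right]
  have hH : ((((SemidirectProduct.inr : GQp p →* PiTpχ p).range : Subgroup (PiTpχ p)).map
      (MulAut.conj (SemidirectProduct.inl (bPowGfp m) : PiTpχ p)).toMonoidHom).map (ThetaSetting.modelχ p).toTheta).map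
        (kummerCoreχ p).augTheta = (⊥ : IntermediateField ℚ_[p] (PadicAlgCl p)).fixingSubgroup := by
    rw [IntermediateField.fixingSubgroup_bot, eq_top_iff]
    rintro σ -
    refine ⟨(ThetaSetting.modelχ p).toTheta ((SemidirectProduct.inl (bPowGfp m) : PiTpχ p) * SemidirectProduct.inr σ *
        (SemidirectProduct.inl (bPowGfp m))⁻¹), ⟨_, ⟨SemidirectProduct.inr σ, ⟨σ, rfl⟩, rfl⟩, rfl⟩, ?_⟩
    rw [(kummerCoreχ p).augTheta_toTheta, aug_conj_inl_bPowGfp]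
    rfl
  exact (kummerCoreχ p).not_exists_package_of_constCompat_of_fixed T hcc ι' hle hfix ⊥ hH

/-! ### §3. ODD lifts fix a conjugate of the 4-torsion section `D_τ` pointwise — NO package (`p ≡ 1 (mod 4)`) -/

/-- The Galois image of `Ad(b^m)(D_τ)`, `D_τ = s_{√−1}(G_K̈)`, is `G_K̈`. [cite: MochizukiEtTh2009, Def 1.9 p.29] -/
theorem map_map_conj_Dtau_augTheta_kummerCoreχ (hp : p % 4 = 1) (m : ZH) :
    ((((ThetaSetting.modelχ p).GKdd.map (sectionOfUnitχ p (sqrtNegOneUnitχ p hp))).map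
        (MulAut.conj (SemidirectProduct.inl (bPowGfp m) : PiTpχ p)).toMonoidHom).map (ThetaSetting.modelχ p).toTheta).map
      (kummerCoreχ p).augTheta = (ThetaSetting.modelχ p).Kdd.fixingSubgroup := by
  ext σ
  constructor
  · rintro ⟨_, ⟨_, ⟨_, ⟨σ', hσ', rfl⟩, rfl⟩, rfl⟩, rfl⟩
    rw [MulEquiv.coe_toMonoidHom, MulAut.conj_apply, (kummerCoreχ p).augTheta_toTheta, aug_conj_inl_bPowGfp,
      aug_modelχ_sectionOfUnitχ]
    exact hσ'
  · intro hσ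
    refine ⟨(ThetaSetting.modelχ p).toTheta ((SemidirectProduct.inl (bPowGfp m) : PiTpχ p) *
        sectionOfUnitχ p (sqrtNegOneUnitχ p hp) σ * (SemidirectProduct.inl (bPowGfp m))⁻¹),
      ⟨_, ⟨sectionOfUnitχ p (sqrtNegOneUnitχ p hp) σ, ⟨σ, hσ, rfl⟩, rfl⟩, rfl⟩, ?_⟩
    rw [(kummerCoreχ p).augTheta_toTheta, aug_conj_inl_bPowGfp, aug_modelχ_sectionOfUnitχ]

/-- **NO-GO for every ODD `b`-axis lift** (`p ≡ 1 (mod 4)`): for `s` odd, `s = m²·s₀` with `s₀` the `τ`-fixing exponent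
of §1, so any `ι'` agreeing pointwise with `Ad(b^s) ∘ ι` fixes `Ad(b^m)(D_τ) ≤ Π^tp_Ÿ` pointwise — Galois image `G_K̈`,
`K̈/ℚ_p` finite (abc-iut-w5-d171's `finiteDimensional_Kdd`) — and abc-iut-w5-d125's no-go applies.
[cite: MochizukiEtTh2009, Prop 1.4 (ii) p.22] -/
theorem not_exists_package_modelχ_oddBTwist_of_constCompat (hp : p % 4 = 1)
    (T : (ThetaSetting.modelχ p).ThetaKummerInput) (hcc : T.ConstCompat (kummerDataχ p)) {s : ZH}
    (hs : ZHatLevel.level 2 s ≠ 1) (ι' : PiTpχ p ≃ₜ* PiTpχ p)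
    (hι' : ∀ x, ι' x = (SemidirectProduct.inl (bPowGfp s) : PiTpχ p) * invχ p x * (SemidirectProduct.inl (bPowGfp s))⁻¹) :
    ¬ ∃ ιFn : T.Fn →* T.Fn,
      (letI := T.instAction; ∀ (g : (ThetaSetting.modelχ p).PiTemp) (f : T.Fn),
        ιFn (g • f) = (ι' : (ThetaSetting.modelχ p).PiTemp ≃ₜ* (ThetaSetting.modelχ p).PiTemp) g • ιFn f) ∧
      (∀ ζ : cyclotome T.Fn, cyclotome.map ιFn ζ = ζ) ∧ ιFn T.theta = T.const (-1) * T.theta := by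
  obtain ⟨s₀, hs₀, hfix₀⟩ := exists_odd_bTwist_invχ_fix_sectionOfUnitχ p hp
  obtain ⟨m, hm⟩ := mul_inv_mem_range_sqHom_of_odd hs hs₀
  rw [sqHom_apply] at hm
  -- `s = m²·s₀`
  have hsm : s * m⁻¹ = m * s₀ := by
    have h1 : s = m ^ 2 * s₀ := by rw [hm, inv_mul_cancel_right]
    rw [h1, pow_two, mul_assoc, mul_assoc, ZHatCompletion.mul_comm s₀, mul_inv_cancel_left]
  haveI := (ThetaSetting.modelχ p).compat.GtpYdd_normal
  haveI : FiniteDimensional ℚ_[p] (ThetaSetting.modelχ p).Kdd := (kummerCoreχ p).finiteDimensional_Kdd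
  have hle : (((ThetaSetting.modelχ p).GKdd.map (sectionOfUnitχ p (sqrtNegOneUnitχ p hp))).map
      (MulAut.conj (SemidirectProduct.inl (bPowGfp m) : PiTpχ p)).toMonoidHom) ≤ (ThetaSetting.modelχ p).GtpYdd := by
    rintro _ ⟨x, hx, rfl⟩
    rw [MulEquiv.coe_toMonoidHom, MulAut.conj_apply]
    exact Subgroup.Normal.conj_mem inferInstance _ (map_sectionOfUnitχ_GKdd_le_GtpYdd p _ hx) _
  have hfix : ∀ g ∈ (((ThetaSetting.modelχ p).GKdd.map (sectionOfUnitχ p (sqrtNegOneUnitχ p hp))).map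
      (MulAut.conj (SemidirectProduct.inl (bPowGfp m) : PiTpχ p)).toMonoidHom), ι' g = g := by
    rintro _ ⟨_, ⟨σ, -, rfl⟩, rfl⟩
    have key : (SemidirectProduct.inl (bPowGfp s) : PiTpχ p) * SemidirectProduct.inl (bPowGfp m⁻¹) =
        SemidirectProduct.inl (bPowGfp m) * SemidirectProduct.inl (bPowGfp s₀) := by
      rw [← map_mul, ← map_mul, ← map_mul, ← map_mul, hsm]
    rw [MulEquiv.coe_toMonoidHom, MulAut.conj_apply, hι', invχ_conj_inl_bPowGfp, conj_conj', key, ← conj_conj',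
      hfix₀ σ]
  exact (kummerCoreχ p).not_exists_package_of_constCompat_of_fixed T hcc ι' hle hfix (ThetaSetting.modelχ p).Kdd
    (map_map_conj_Dtau_augTheta_kummerCoreχ p hp m)

/-! ### §4. Every `b`-axis lift (`p ≡ 1 (mod 4)`) -/

/-- **NO `b`-AXIS LIFT OF THE INVERSION OF RECORD CARRIES THE FUNCTION-LEVEL PACKAGE** (`p ≡ 1 (mod 4)`, every `s ∈ Ẑ`):
for every theta-Kummer input `T` over `modelχ` compatible with the genuine Kummer data `kummerDataχ p` and every
`ι' : Π^tp_X ≃ₜ* Π^tp_X` agreeing pointwise with `Ad(b^s) ∘ ι`, there is NO pull-back of functions `ιFn` with the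
[EtTh] Prop 1.4 (ii) package `hιFn ∧ hΛ ∧ hιθ`. abc-iut-w5-d125's memo (5) escape is closed on the `b`-axis.
[cite: MochizukiEtTh2009, Prop 1.4 (ii) p.22] -/
theorem not_exists_package_modelχ_bTwist_of_constCompat (hp : p % 4 = 1)
    (T : (ThetaSetting.modelχ p).ThetaKummerInput) (hcc : T.ConstCompat (kummerDataχ p)) (s : ZH)
    (ι' : PiTpχ p ≃ₜ* PiTpχ p)
    (hι' : ∀ x, ι' x = (SemidirectProduct.inl (bPowGfp s) : PiTpχ p) * invχ p x * (SemidirectProduct.inl (bPowGfp s))⁻¹) :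
    ¬ ∃ ιFn : T.Fn →* T.Fn,
      (letI := T.instAction; ∀ (g : (ThetaSetting.modelχ p).PiTemp) (f : T.Fn),
        ιFn (g • f) = (ι' : (ThetaSetting.modelχ p).PiTemp ≃ₜ* (ThetaSetting.modelχ p).PiTemp) g • ιFn f) ∧
      (∀ ζ : cyclotome T.Fn, cyclotome.map ιFn ζ = ζ) ∧ ιFn T.theta = T.const (-1) * T.theta := by
  by_cases hs : ZHatLevel.level 2 s = 1
  · exact not_exists_package_modelχ_evenBTwist_of_constCompat p T hcc
      ((mem_range_sqHom_iff s).mpr (by rw [modN_eq_level]; exact hs)) ι' hι'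
  · exact not_exists_package_modelχ_oddBTwist_of_constCompat p hp T hcc hs ι' hι'

end Literature.AnabelianGeometry.EtaleTheta.SettingModel

end
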